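import Summits.CriticalPhenomena.PercolationContinuityZ3.Theorems.PercNearOneGluingNoHeavyLowerTailStarSetAggregation
import Summits.CriticalPhenomena.PercolationContinuityZ3.Theorems.PercNearOneGluingNoHeavyLowerTailStarSetWordCaps
import HarnessLib

/-!
# `NoHeavyLowerTail` (stmt-CriticalPhenomena-4575) — load of the regular units on their balanced-pair words (U1-PROOF.md §3; blueprint B5b/F2/F5)

Support file (prover `prim-gen-swap` gen 13; `--supports stmt-CriticalPhenomena-4575`).  No definitions, no named facts, no sorries.

The REGULAR family of the charging scheme (U1-PROOF.md §3, rules A1/A2; LEAN-BLUEPRINT-U1.md §C, §F2, §F5): a unit `u = (S, H)` (configuration `S`,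
hub `H ∈ S` a chord) with a partner `Q = part u ∈ S` and a third class `N = third u ∈ F` dominating `H` or `Q` is charged to the balanced pair of
designations `(δ₁ u, δ₂ u)` of the class-set `T = {H, Q, N}` (complementary on each class).  For every such word `w = (T, δ₁, δ₂)` the claimant pairs
`(H, Q)` are pairs of distinct classes of `T` with `H ∉ F`; since `T` contains the forest class `N` there are at most four of them, and the units of one
claimant pair lie in the cylinder `{S ⊇ {H, Q}}`, of total weight `≤ θ_Hθ_Q ≤ cap(w)/8` (`weighted_sum_le_pair`, `balanced_word_cap_ge`).  Hence the
family's load on each of its words is at most `4/8` of the word's capacity `cap(w) = Π_T O(δ₁) + Π_T O(δ₂)`: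

* `StarSet.card_pairs_le_four` — `#{(H,Q) ∈ T×T : H ≠ Q, H ∉ F} ≤ 4` for `#T = 3` with an element in `F`;
* `StarSet.regular_pair_load_le` — one claimant pair: `Σ W ≤ cap/8`;
* `StarSet.load_regular_le` — the family statement `Σ_{u∈U} W(S_u) ≤ (1/2)·Σ_{w ∈ res(U)} cap w`.
-/

namespace Summit.CriticalPhenomena.PercolationContinuityZ3.Theorems

open Finset
open scoped BigOperators

namespace StarSet

variable {ι V : Type*} [Fintype ι] [DecidableEq ι]

omit [Fintype ι] in
/-- At most four ordered pairs `(H, Q)` of distinct elements of a 3-set `T` have `H ∉ F` when `T` meets `F`. -/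
theorem card_pairs_le_four (F T : Finset ι) {N : ι} (hNT : N ∈ T) (hNF : N ∈ F) (hT : T.card = 3) :
    ((T ×ˢ T).filter (fun p : ι × ι => p.1 ≠ p.2 ∧ p.1 ∉ F)).card ≤ 4 := by
  classical
  have hsub : (T ×ˢ T).filter (fun p : ι × ι => p.1 ≠ p.2 ∧ p.1 ∉ F) ⊆ (T.erase N) ×ˢ T \ (T.erase N).image (fun H => (H, H)) := by
    intro p hp
    simp only [mem_filter, mem_product] at hp
    obtain ⟨⟨h1, h2⟩, hne, hF⟩ := hp
    rw [mem_sdiff, mem_product, mem_image]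
    refine ⟨⟨mem_erase.2 ⟨fun h => hF (h ▸ hNF), h1⟩, h2⟩, ?_⟩
    rintro ⟨H, _, hH⟩
    exact hne (by rw [← hH])
  refine (card_le_card hsub).trans ?_
  have hinj : Set.InjOn (fun H : ι => (H, H)) ↑(T.erase N) := fun a _ b _ h => (Prod.mk.inj h).1
  have himg_sub : (T.erase N).image (fun H => (H, H)) ⊆ (T.erase N) ×ˢ T := by
    intro p hp
    obtain ⟨H, hH, rfl⟩ := mem_image.1 hp
    exact mem_product.2 ⟨hH, mem_of_mem_erase hH⟩
  rw [card_sdiff_of_subset himg_sub, card_image_of_injOn hinj, card_product, card_erase_of_mem hNT, hT]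

/-- **One claimant pair (U1-PROOF §3 with F2): `Σ_{units with hub H, partner Q} W(S) ≤ cap/8`.**  The units are distinct configurations
`S ⊇ {H, Q}`; `cap = Π_T O(δ₁) + Π_T O(δ₂)` for `T = {H, Q, N}` with complementary designations, and `N` dominates `H` or `Q`. -/
theorem regular_pair_load_le (θ : ι → ℝ) (hθ0 : ∀ i, 0 ≤ θ i) (hθ1 : ∀ i, θ i ≤ 1) (P P' : ι → V)
    (O : ι → V → ℝ) (hO0 : ∀ X d, 0 ≤ O X d) (Φ : ι → ℝ)
    (hO2 : ∀ X, Φ X ^ 2 ≤ O X (P X) * O X (P' X)) (hΦ4 : ∀ X, 4 * θ X ≤ Φ X) (hΦsq : ∀ X, θ X ≤ Φ X ^ 2)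
    {H Q N : ι} (hHQ : H ≠ Q) (hHN : H ≠ N) (hQN : Q ≠ N) (hdom : θ H ≤ θ N ∨ θ Q ≤ θ N)
    (δ₁ δ₂ : ι → Bool) (hcomp : ∀ X ∈ ({H, Q, N} : Finset ι), δ₁ X ≠ δ₂ X)
    (C : Finset (Finset ι)) (hC : ∀ S ∈ C, H ∈ S ∧ Q ∈ S) :
    ∑ S ∈ C, ((∏ k ∈ S, θ k) * ∏ k ∈ univ \ S, (1 - θ k)) ≤
      ((∏ X ∈ ({H, Q, N} : Finset ι), O X (if δ₁ X then P X else P' X)) +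
        ∏ X ∈ ({H, Q, N} : Finset ι), O X (if δ₂ X then P X else P' X)) / 8 := by
  classical
  -- aggregation over the cylinder `{S ⊇ {H,Q}}`
  have hagg : ∑ S ∈ C, ((∏ k ∈ S, θ k) * ∏ k ∈ univ \ S, (1 - θ k)) ≤ θ H * θ Q := by
    have h := weighted_sum_le_pair θ hθ0 hθ1 hHQ (fun S => if S ∈ C then (1 : ℝ) else 0)
      (fun S => by by_cases h : S ∈ C <;> simp [h]) (fun S hS => by
        by_cases h : S ∈ C
        · exact hC S h
        · simp [h] at hS)
    have hsub : C ⊆ (univ : Finset ι).powerset := fun S _ => mem_powerset.2 (subset_univ S)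
    simp_rw [mul_boole] at h
    rw [sum_ite_mem, inter_eq_right.2 hsub] at h
    exact h
  -- the complementary products
  have hHQN : H ∉ ({Q, N} : Finset ι) := by simp [hHQ, hHN]
  have hprod : ∀ δ : ι → Bool, ∏ X ∈ ({H, Q, N} : Finset ι), O X (if δ X then P X else P' X) =
      O H (if δ H then P H else P' H) * (O Q (if δ Q then P Q else P' Q) * O N (if δ N then P N else P' N)) := by
    intro δ; rw [prod_insert hHQN, prod_pair hQN]
  have hpair : ∀ X ∈ ({H, Q, N} : Finset ι),
      Φ X ^ 2 ≤ O X (if δ₁ X then P X else P' X) * O X (if δ₂ X then P X else P' X) := by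
    intro X hX
    have hc := hcomp X hX
    cases h1 : δ₁ X <;> cases h2 : δ₂ X <;> simp only [h1, h2] at hc ⊢
    · exact absurd rfl hc
    · rw [mul_comm]; exact hO2 X
    · exact hO2 X
    · exact absurd rfl hc
  have hH3 : H ∈ ({H, Q, N} : Finset ι) := by simp
  have hQ3 : Q ∈ ({H, Q, N} : Finset ι) := by simp
  have hN3 : N ∈ ({H, Q, N} : Finset ι) := by simp
  have hΦ0 : ∀ X, 0 ≤ Φ X := fun X => by linarith [hΦ4 X, hθ0 X]
  rw [hprod δ₁, hprod δ₂]
  -- `8 θ_H θ_Q ≤ cap` by `balanced_word_cap_ge` with the dominated class in the rôle of `X`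
  rcases hdom with hd | hd
  · have h8 := balanced_word_cap_ge (θ H) (θ Q) (θ N) (Φ H) (Φ Q) (Φ N)
      (O H (if δ₁ H then P H else P' H)) (O H (if δ₂ H then P H else P' H))
      (O Q (if δ₁ Q then P Q else P' Q)) (O Q (if δ₂ Q then P Q else P' Q))
      (O N (if δ₁ N then P N else P' N)) (O N (if δ₂ N then P N else P' N))
      (hθ0 H) (hθ0 Q) hd (hΦ0 H) (hΦ0 N) (hΦ4 Q) (hΦsq H) (hΦsq N)
      (hO0 _ _) (hO0 _ _) (hO0 _ _) (hO0 _ _) (hO0 _ _) (hO0 _ _) (hpair H hH3) (hpair Q hQ3) (hpair N hN3)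
    have : θ H * θ Q ≤ (O H (if δ₁ H then P H else P' H) * (O Q (if δ₁ Q then P Q else P' Q) * O N (if δ₁ N then P N else P' N)) +
        O H (if δ₂ H then P H else P' H) * (O Q (if δ₂ Q then P Q else P' Q) * O N (if δ₂ N then P N else P' N))) / 8 := by
      rw [le_div_iff₀ (by norm_num : (0 : ℝ) < 8)]; linarith
    exact hagg.trans this
  · have h8 := balanced_word_cap_ge (θ Q) (θ H) (θ N) (Φ Q) (Φ H) (Φ N)
      (O Q (if δ₁ Q then P Q else P' Q)) (O Q (if δ₂ Q then P Q else P' Q))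
      (O H (if δ₁ H then P H else P' H)) (O H (if δ₂ H then P H else P' H))
      (O N (if δ₁ N then P N else P' N)) (O N (if δ₂ N then P N else P' N))
      (hθ0 Q) (hθ0 H) hd (hΦ0 Q) (hΦ0 N) (hΦ4 H) (hΦsq Q) (hΦsq N)
      (hO0 _ _) (hO0 _ _) (hO0 _ _) (hO0 _ _) (hO0 _ _) (hO0 _ _) (hpair Q hQ3) (hpair H hH3) (hpair N hN3)
    have : θ H * θ Q ≤ (O H (if δ₁ H then P H else P' H) * (O Q (if δ₁ Q then P Q else P' Q) * O N (if δ₁ N then P N else P' N)) +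
        O H (if δ₂ H then P H else P' H) * (O Q (if δ₂ Q then P Q else P' Q) * O N (if δ₂ N then P N else P' N))) / 8 := by
      rw [le_div_iff₀ (by norm_num : (0 : ℝ) < 8)]; linarith
    exact hagg.trans this

/-- **Load of the regular family (U1-PROOF §3, §9; F2/F5): `Σ_{u∈U} W(S_u) ≤ ½·Σ_{w ∈ res(U)} cap(w)`.**  Units `u = (S, H)` with hub `H = u.2 ∈ S`,
`H ∉ F`, partner `part u ∈ S`, third class `third u ∈ F` dominating the hub or the partner, resource `res u = ({H, part u, third u}, δ₁ u, δ₂ u)` with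
complementary designations; `cap (T, δ₁, δ₂) = Π_T O(δ₁) + Π_T O(δ₂)`. -/
theorem load_regular_le (θ : ι → ℝ) (hθ0 : ∀ i, 0 ≤ θ i) (hθ1 : ∀ i, θ i ≤ 1) (P P' : ι → V) (F : Finset ι)
    (O : ι → V → ℝ) (hO0 : ∀ X d, 0 ≤ O X d) (Φ : ι → ℝ)
    (hO2 : ∀ X, Φ X ^ 2 ≤ O X (P X) * O X (P' X)) (hΦ4 : ∀ X, 4 * θ X ≤ Φ X) (hΦsq : ∀ X, θ X ≤ Φ X ^ 2)
    (U : Finset (Finset ι × ι)) (part third : Finset ι × ι → ι) (res : Finset ι × ι → Finset ι × ((ι → Bool) × (ι → Bool)))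
    (hU : ∀ u ∈ U, u.2 ∈ u.1 ∧ u.2 ∉ F ∧ part u ∈ u.1 ∧ part u ≠ u.2 ∧ third u ∈ F ∧ third u ≠ u.2 ∧ third u ≠ part u ∧
      (θ u.2 ≤ θ (third u) ∨ θ (part u) ≤ θ (third u)) ∧ (res u).1 = {u.2, part u, third u} ∧
      ∀ X ∈ (res u).1, (res u).2.1 X ≠ (res u).2.2 X) :
    ∑ u ∈ U, ((∏ k ∈ u.1, θ k) * ∏ k ∈ univ \ u.1, (1 - θ k)) ≤
      (1 / 2) * ∑ w ∈ U.image res, ((∏ X ∈ w.1, O X (if w.2.1 X then P X else P' X)) +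
        ∏ X ∈ w.1, O X (if w.2.2 X then P X else P' X)) := by
  classical
  rw [mul_sum, ← sum_fiberwise_of_maps_to (fun u hu => mem_image_of_mem res hu)]
  refine sum_le_sum fun w hw => ?_
  obtain ⟨u₀, hu₀, hu₀w⟩ := mem_image.1 hw
  obtain ⟨-, hH₀F, -, hpH₀, hN₀F, hNH₀, hNp₀, -, hT₀, -⟩ := hU u₀ hu₀
  -- the word `w = (T, δ₁, δ₂)`; `T` has three elements and meets `F`
  have hTcard : w.1.card = 3 := by
    rw [← hu₀w, hT₀, card_insert_of_notMem (by simp [Ne.symm hpH₀, Ne.symm hNH₀]), card_pair (Ne.symm hNp₀)]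
  have hN₀T : third u₀ ∈ w.1 := by rw [← hu₀w, hT₀]; simp
  -- split the fibre by claimant pair `(hub, partner)`
  set pairs := (w.1 ×ˢ w.1).filter (fun p : ι × ι => p.1 ≠ p.2 ∧ p.1 ∉ F) with hpairs
  have hmaps : ∀ u ∈ U.filter (fun u => res u = w), (u.2, part u) ∈ pairs := by
    intro u hu
    obtain ⟨huU, huw⟩ := mem_filter.1 hu
    obtain ⟨-, hHF, -, hpH, -, -, -, -, hT, -⟩ := hU u huU
    rw [hpairs, mem_filter, mem_product, ← huw, hT]
    exact ⟨⟨by simp, by simp⟩, Ne.symm hpH, hHF⟩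
  rw [← sum_fiberwise_of_maps_to hmaps]
  have hcap0 : 0 ≤ (∏ X ∈ w.1, O X (if w.2.1 X then P X else P' X)) + ∏ X ∈ w.1, O X (if w.2.2 X then P X else P' X) :=
    add_nonneg (prod_nonneg fun X _ => hO0 _ _) (prod_nonneg fun X _ => hO0 _ _)
  -- each claimant pair contributes at most `cap/8`
  have hper : ∀ p ∈ pairs, ∑ u ∈ (U.filter (fun u => res u = w)).filter (fun u => (u.2, part u) = p),
      ((∏ k ∈ u.1, θ k) * ∏ k ∈ univ \ u.1, (1 - θ k)) ≤
      ((∏ X ∈ w.1, O X (if w.2.1 X then P X else P' X)) + ∏ X ∈ w.1, O X (if w.2.2 X then P X else P' X)) / 8 := by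
    intro p _
    set Up := (U.filter (fun u => res u = w)).filter (fun u => (u.2, part u) = p) with hUp
    rcases Up.eq_empty_or_nonempty with hemp | ⟨u₁, hu₁⟩
    · rw [hemp, sum_empty]; exact div_nonneg hcap0 (by norm_num)
    -- a witness unit fixes hub, partner, third and the designations
    have hu₁' := mem_filter.1 hu₁
    have hu₁U : u₁ ∈ U := (mem_filter.1 hu₁'.1).1
    have hu₁w : res u₁ = w := (mem_filter.1 hu₁'.1).2
    obtain ⟨-, -, -, hpH₁, -, hNH₁, hNp₁, hdom₁, hT₁, hcomp₁⟩ := hU u₁ hu₁U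
    -- the units of `Up` are `(S, H₁)` with distinct `S ∋ H₁, part = Q₁`; map them to their configurations
    have hinjS : Set.InjOn (fun u : Finset ι × ι => u.1) ↑Up := by
      intro u hu v hv huv
      have hu2 : (u.2, part u) = p := (mem_filter.1 (mem_coe.1 hu)).2
      have hv2 : (v.2, part v) = p := (mem_filter.1 (mem_coe.1 hv)).2
      exact Prod.ext huv (by rw [← (Prod.mk.inj (hu2.trans hv2.symm)).1])
    rw [← sum_image (f := fun S : Finset ι => (∏ k ∈ S, θ k) * ∏ k ∈ univ \ S, (1 - θ k)) hinjS]
    have hC : ∀ S ∈ Up.image (fun u : Finset ι × ι => u.1), u₁.2 ∈ S ∧ part u₁ ∈ S := by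
      intro S hS
      obtain ⟨u, hu, rfl⟩ := mem_image.1 hS
      have hu' := mem_filter.1 hu
      have huU : u ∈ U := (mem_filter.1 hu'.1).1
      have hup : (u.2, part u) = p := hu'.2
      have hu₁p : (u₁.2, part u₁) = p := hu₁'.2
      obtain ⟨h1, h2⟩ := Prod.mk.inj (hup.trans hu₁p.symm)
      obtain ⟨hHS, -, hpS, -⟩ := hU u huU
      exact ⟨h1 ▸ hHS, h2 ▸ hpS⟩
    have key := regular_pair_load_le θ hθ0 hθ1 P P' O hO0 Φ hO2 hΦ4 hΦsq (Ne.symm hpH₁) (Ne.symm hNH₁) (Ne.symm hNp₁) hdom₁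
      (res u₁).2.1 (res u₁).2.2 (fun X hX => hcomp₁ X (hT₁ ▸ hX)) (Up.image (fun u : Finset ι × ι => u.1)) hC
    rw [← hT₁, hu₁w] at key
    exact key
  calc ∑ p ∈ pairs, ∑ u ∈ (U.filter (fun u => res u = w)).filter (fun u => (u.2, part u) = p),
        ((∏ k ∈ u.1, θ k) * ∏ k ∈ univ \ u.1, (1 - θ k))
      ≤ ∑ p ∈ pairs, ((∏ X ∈ w.1, O X (if w.2.1 X then P X else P' X)) + ∏ X ∈ w.1, O X (if w.2.2 X then P X else P' X)) / 8 :=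
        sum_le_sum hper
    _ = pairs.card * (((∏ X ∈ w.1, O X (if w.2.1 X then P X else P' X)) + ∏ X ∈ w.1, O X (if w.2.2 X then P X else P' X)) / 8) := by
        rw [sum_const, nsmul_eq_mul]
    _ ≤ 4 * (((∏ X ∈ w.1, O X (if w.2.1 X then P X else P' X)) + ∏ X ∈ w.1, O X (if w.2.2 X then P X else P' X)) / 8) := by
        refine mul_le_mul_of_nonneg_right ?_ (div_nonneg hcap0 (by norm_num))
        exact_mod_cast card_pairs_le_four F w.1 hN₀T hN₀F hTcard
    _ = (1 / 2) * ((∏ X ∈ w.1, O X (if w.2.1 X then P X else P' X)) + ∏ X ∈ w.1, O X (if w.2.2 X then P X else P' X)) := by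
        ring

end StarSet

end Summit.CriticalPhenomena.PercolationContinuityZ3.Theorems
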